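import Literature.Geometry.Lorentzian.HomotheticSurfaceGravity
import HarnessLib

/-!
# Periodic generators of the vertex past cone, iterated surface gravity, cone completeness

Definition item `defn-SelfSimilarVacuumProfile.IsPeriodicGenerator` (topic
`Literature/Geometry/Lorentzian`; request D4 of route `FinalStateConjecture/HomotheticSurfaceGravity`,
repair of the benign branch, 2026-08-16). It extends `HomotheticSurfaceGravity.lean` (same namespace
`Literature.Geometry.Lorentzian.SelfSimilarVacuumProfile`, `Z` a self-similar vacuum profile with
discrete homothety `Φ = Z.dilation`, vertex past cone `𝒩 = Z.cone`) from generators invariant under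
`Φ` to generators invariant under an **iterate** `Φ^k` — the iterates of a discrete homothety are
discrete homotheties, `(φ_*)^n g = e^{2nΔ} g` (Gundlach 1997, §2.2) — and names the completeness
clause of the cone used by the route. No fact is asserted; everything below is a definition or is
proved.

## Contents

* `IsPeriodicDilationContraction Z k γ c`: `0 < c < 1` and `Φ^{-k}(γ u) = γ(c u)` for all `u < 0`
  (`k = 1`: `IsDilationContraction`, `isPeriodicDilationContraction_one_iff`).
* `IsPeriodicGenerator Z k γ`: `γ` is a maximal geodesic on `(-∞, 0)` (vertex end at `u = 0`), an
  affinely parametrised future-directed null geodesic generator of `𝒩` there (Galloway 2000, §2.1),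
  injective, and `Φ^{-k}` acts on it by some periodic dilation contraction — a **`k`-periodic
  generator in normalised affine parametrisation** (homotheties preserve Levi-Civita connections,
  hence affinely parametrised geodesics and causal character, O'Neill 1983, Ch. 3, Lemma 64 and
  Remark 65). API: `isPeriodicGenerator_one_iff` (`k = 1` ⇔ `IsInvariantGenerator`),
  `IsInvariantGenerator.isPeriodicGenerator` (period `k ≠ 0`, contraction `c₀^k`),
  `IsPeriodicGenerator.mul_right` (period `k` ⇒ period `k m`), `IsPeriodicGenerator.ne_zero`/`one_le`
  (the period of an injective curve is never `0`), uniqueness of `c` (`IsPeriodicDilationContraction.unique`),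
  set forms `image_iterate_dilation_symm`, `image_iterate_dilation`.
* `affineContractionIter Z k γ = c` (junk `1`), `screenContractionIter Z k γ = exp(½ ∫_{-1}^{-c} θ_{γ'})`,
  `homotheticSurfaceGravityIter Z k γ = log c / log μ = 2 log c / ∫_{-1}^{-c} θ_{γ'}`
  (`homotheticSurfaceGravityIter_eq`, `homotheticSurfaceGravityIter_eq_log_div`); at `k = 1` these
  are `affineContraction`, `screenContraction`, `homotheticSurfaceGravity` (`…_one`, by `rfl`). For a
  `k`-periodic generator, `affineContractionIter (k m) = (affineContractionIter k)^m`, and GIVEN the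
  `Φ^k`-equivariance of the expansion along `γ` (`θ(t) = c θ(c t)`, see *Design*) also
  `screenContractionIter (k m) = (screenContractionIter k)^m` and
  `homotheticSurfaceGravityIter (k m) = homotheticSurfaceGravityIter k`; in particular
  `IsInvariantGenerator.homotheticSurfaceGravityIter_eq`: `α_k = α` for an invariant generator.
* `coneTrivLine e ω u = e⁻¹(ω, log(-u))` for a trivialisation `e : 𝒩 ≃ₜ S² × ℝ`, and
  `IsConeComplete Z`: there is such an `e` all of whose lines `u ↦ e⁻¹(ω, log(-u))`, `u < 0`, are
  maximal geodesics on `(-∞,0)` and generators of `𝒩` there — **the vertex past cone is complete**: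
  its space of generators is a 2-sphere and every generator is a maximal affinely parametrised
  future-directed null geodesic with finite future (vertex) end `u ↑ 0` and parameter `s = log(-u)`
  along the `ℝ`-factor (Rodnianski–Shlapentokh-Rothman 2023, Thm. 1: the cone `{v̂ = 0}` is
  `[u] × S²`, `u ∈ [-v̲², 0)`, with the scaling field `S = u ∂_u` tangent to it; Christodoulou 2009,
  Ch. 1, §1.1: the generators of a cone `C_o` are the affinely parametrised future-directed null
  geodesics from `o`, one per direction). API: `injOn_coneTrivLine`, `exists_coneTrivLine_eq` (the
  line through a point of `𝒩`), `iUnion_image_coneTrivLine`, `IsConeComplete.exists_generator`.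
* Bridges to the inline clauses of the route items `BenignProfileRigidityR`, `PeriodicShearRigidity`
  (which spell these notions out verbatim): `isPeriodicGenerator_iff`, `isConeComplete_iff`
  (`Iff.rfl`), `exists_isPeriodicGenerator_iff`, `exists_isPeriodicGenerator_lt_iff` and
  `exists_exists_isPeriodicGenerator_lt_iff` (the conclusion of `BenignProfileRigidityR` ⇔
  `∃ k γ, IsPeriodicGenerator k γ ∧ 1 < homotheticSurfaceGravityIter k γ`),
  `forall_isPeriodicGenerator_iff` (the hypothesis of `PeriodicShearRigidity` ⇔ a statement about
  all periodic generators), `IsConeComplete.isPeriodicGenerator_coneTrivLine`.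

## Design

* **Literal match.** The bodies of `IsPeriodicDilationContraction`, `IsPeriodicGenerator`,
  `IsConeComplete` and the quotient `log c / ((∫_{-1}^{-c} θ_{γ'})/2)` are, token for token, the
  clauses inlined in the route items, so the named forms are definitional rewrites.
* **Equivariance hypothesis.** `θ` is `Φ`-equivariant (`θ_{dΦ⁻¹ℓ}(Φ⁻¹y) = θ_ℓ(y)`: areas scale by a
  constant under a homothety, which drops out of the logarithmic derivative), and
  `dΦ^{-k} γ'(u) = c γ'(c u)` along a `k`-periodic generator, whence `θ_{γ'}(t) = c θ_{γ'}(c t)`.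
  This is a statement about `hessian`/`leviCivita` under homotheties that the tree cannot yet prove
  (cf. the *Base point* note of `HomotheticSurfaceGravity.lean`), so the iteration invariance of
  `μ` and `α` carries it as the hypothesis `∀ t < 0, θ t = c * θ (c * t)`; the underlying real
  identity `∫_{-1}^{-c^m} θ = m ∫_{-1}^{-c} θ` (`integral_eq_mul_of_forall_eq_mul`) holds without
  integrability assumptions (both sides vanish in the non-integrable case).
* **Trivialisation in `log(-u)`.** With `s = log(-u)` the `u`-lines of `e` are defined exactly for
  `u < 0` and exhaust `e⁻¹({ω} × ℝ)`; injectivity of each line on `(-∞,0)` (`injOn_coneTrivLine`) is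
  then automatic, so every line of a complete cone satisfies the `InjOn` clause of
  `IsPeriodicGenerator`.
* **Junk values.** `affineContractionIter = 1` (so `α_k = 0`) when no periodic contraction exists;
  `IsPeriodicGenerator 0 γ` is false (`not_isPeriodicGenerator_zero`).
* Not here: `Z.cone = frontier Z.past`, existence of periodic generators on a complete cone (a
  fixed-point statement about the return map on `S²`; it is the content of route items, not a
  definition), and the `Φ`-equivariance of `θ` itself.

## References

* C. Gundlach, *Understanding critical collapse of a scalar field*, Phys. Rev. D 55 (1997) 695–713
  = arXiv:gr-qc/9604019, §2.2 (discrete self-similarity, `(φ_*)^n g = e^{2nΔ} g`).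
* B. O'Neill, *Semi-Riemannian geometry*, Academic Press 1983, Ch. 3, Def. 63, Lemma 64, Remark 65
  (homotheties preserve Levi-Civita connections, geodesics, causal character).
* G. J. Galloway, Ann. Henri Poincaré 1 (2000) 543–567 = arXiv:math/9909158, §2.1 (null geodesic
  generators; affinely parametrised generators `η : (a,b) → M`).
* I. Rodnianski, Y. Shlapentokh-Rothman, Ann. of Math. 198 (2023) = arXiv:1912.08478, Thm. 1
  (`(u, v̂, θ) ∈ [-v̲², 0) × [0, ∞) × S²`; the cone `{v̂ = 0}`; `S = u∂_u`), Def. 2.3.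
* D. Christodoulou, *The formation of black holes in general relativity*, EMS 2009 =
  arXiv:0805.3880, Ch. 1, §1.1 (generators of `C_o`, affine parameter, no cut/conjugate points).
* R. M. Wald, *General Relativity*, 1984, §12.5 (Killing-horizon analogue of the rescaling of the
  affine parameter along generators).
-/

noncomputable section

open Bundle Set Function Filter intervalIntegral
open _root_.MeasureTheory
open scoped Manifold ContDiff _root_.Topology

namespace Literature.Geometry.Lorentzian

namespace SelfSimilarVacuumProfile

universe u

variable {n : ℕ∞ω} [Fact (1 ≤ n)] (Z : SelfSimilarVacuumProfile.{u} n)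

/-! ### Periodic dilation contractions and periodic generators -/

/-- `Φ^{-k}` **acts on the curve `γ` (parametrised by `(-∞, 0)`) as the dilation contraction
`u ↦ c u`** with `0 < c < 1`: `(Φ⁻¹)^[k] (γ u) = γ (c u)` for all `u < 0`. The iterate `Φ^k` of the
discrete homothety is a discrete homothety of log-scale `kΔ` (Gundlach 1997, §2.2,
`(φ_*)^n g = e^{2nΔ} g`), so this is `IsDilationContraction` for `Φ^k` in place of `Φ`
(`isPeriodicDilationContraction_one_iff`). Object posited by route
`HomotheticSurfaceGravity` (final-state summit). [folklore] -/
def IsPeriodicDilationContraction (k : ℕ) (γ : ℝ → Z.carrier) (c : ℝ) : Prop :=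
  0 < c ∧ c < 1 ∧ ∀ u : ℝ, u < 0 → (Z.dilation.symm)^[k] (γ u) = γ (c * u)

/-- `γ` is a **`k`-periodic generator of the vertex past cone, in normalised affine
parametrisation**: a maximal geodesic with parameter domain `(-∞, 0)` (vertex end at `u = 0`, finite
future affine length), an affinely parametrised future-directed null geodesic generator of `𝒩` there
(Galloway 2000, §2.1), injective on `(-∞, 0)`, on which `Φ^{-k}` acts by a dilation contraction
`u ↦ c u`, `0 < c < 1` — i.e. an invariant generator of the discrete homothety `Φ^k` (homotheties map
affinely parametrised geodesics to affinely parametrised geodesics and preserve causal character,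
O'Neill 1983, Ch. 3, Lemma 64 and Remark 65; `Φ⁻¹` preserves the time orientation and the vertex
end). `k = 1` is `IsInvariantGenerator` (`isPeriodicGenerator_one_iff`). Object posited by route
`HomotheticSurfaceGravity` (final-state summit). [folklore] -/
def IsPeriodicGenerator (k : ℕ) (γ : ℝ → Z.carrier) : Prop :=
  IsMaximalGeodesicOn Z.metric.leviCivita γ (Iio 0) ∧ Z.IsConeGeneratorOn γ (Iio 0) ∧
    InjOn γ (Iio 0) ∧ ∃ c, Z.IsPeriodicDilationContraction k γ c

/-- Unfolding of `IsPeriodicDilationContraction` (the clause inlined in the route items). [folklore] -/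
theorem isPeriodicDilationContraction_iff {k : ℕ} {γ : ℝ → Z.carrier} {c : ℝ} :
    Z.IsPeriodicDilationContraction k γ c ↔
      0 < c ∧ c < 1 ∧ ∀ u : ℝ, u < 0 → (Z.dilation.symm)^[k] (γ u) = γ (c * u) :=
  Iff.rfl

/-- Unfolding of `IsPeriodicGenerator` into the clause inlined in the route items
`BenignProfileRigidityR` / `PeriodicShearRigidity`. [folklore] -/
theorem isPeriodicGenerator_iff {k : ℕ} {γ : ℝ → Z.carrier} :
    Z.IsPeriodicGenerator k γ ↔
      IsMaximalGeodesicOn Z.metric.leviCivita γ (Iio 0) ∧ Z.IsConeGeneratorOn γ (Iio 0) ∧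
        InjOn γ (Iio 0) ∧
          ∃ c, 0 < c ∧ c < 1 ∧ ∀ u : ℝ, u < 0 → (Z.dilation.symm)^[k] (γ u) = γ (c * u) :=
  Iff.rfl

/-- Period one: `IsPeriodicDilationContraction 1 = IsDilationContraction`. [folklore] -/
theorem isPeriodicDilationContraction_one_iff {γ : ℝ → Z.carrier} {c : ℝ} :
    Z.IsPeriodicDilationContraction 1 γ c ↔ Z.IsDilationContraction γ c :=
  Iff.rfl

/-- Period one: a `1`-periodic generator is an invariant generator. [folklore] -/
theorem isPeriodicGenerator_one_iff {γ : ℝ → Z.carrier} :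
    Z.IsPeriodicGenerator 1 γ ↔ Z.IsInvariantGenerator γ :=
  Iff.rfl

namespace IsPeriodicDilationContraction

variable {Z} {k : ℕ} {γ : ℝ → Z.carrier} {c c' : ℝ}

/-- `0 < c`. [folklore] -/
lemma pos (h : Z.IsPeriodicDilationContraction k γ c) : 0 < c := h.1

/-- `c < 1`. [folklore] -/
lemma lt_one (h : Z.IsPeriodicDilationContraction k γ c) : c < 1 := h.2.1

/-- `Φ^{-k}(γ u) = γ(c u)` for `u < 0`. [folklore] -/
lemma iterate_dilation_symm_apply (h : Z.IsPeriodicDilationContraction k γ c) {u : ℝ}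
    (hu : u < 0) : (Z.dilation.symm)^[k] (γ u) = γ (c * u) :=
  h.2.2 u hu

/-- `c u < 0` for `u < 0`. [folklore] -/
lemma mul_neg (h : Z.IsPeriodicDilationContraction k γ c) {u : ℝ} (hu : u < 0) : c * u < 0 :=
  mul_neg_of_pos_of_neg h.1 hu

/-- `Φ^{k}(γ(c u)) = γ u` for `u < 0`. [folklore] -/
lemma iterate_dilation_apply (h : Z.IsPeriodicDilationContraction k γ c) {u : ℝ} (hu : u < 0) :
    (Z.dilation)^[k] (γ (c * u)) = γ u := by
  rw [← h.iterate_dilation_symm_apply hu]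
  exact Function.LeftInverse.iterate (g := Z.dilation) Z.dilation.apply_symm_apply k (γ u)

/-- `Φ^{k}(γ u) = γ(u / c)` for `u < 0`: `Φ^k` acts by the expansion `u ↦ u / c`. [folklore] -/
lemma iterate_dilation_apply' (h : Z.IsPeriodicDilationContraction k γ c) {u : ℝ} (hu : u < 0) :
    (Z.dilation)^[k] (γ u) = γ (u / c) := by
  have hu' : u / c < 0 := div_neg_of_neg_of_pos hu h.1
  have := h.iterate_dilation_apply hu'
  rwa [mul_div_cancel₀ u h.1.ne'] at this

/-- **Iteration**: `Φ^{-km}(γ u) = γ(c^m u)`. Gundlach 1997, §2.2. [cite: Gundlach1997, §2.2] -/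
lemma iterate_mul_dilation_symm_apply (h : Z.IsPeriodicDilationContraction k γ c) (m : ℕ) {u : ℝ}
    (hu : u < 0) : (Z.dilation.symm)^[k * m] (γ u) = γ (c ^ m * u) := by
  induction m with
  | zero => simp
  | succ m ih =>
    rw [Nat.mul_succ, add_comm, iterate_add_apply, ih,
      h.iterate_dilation_symm_apply (mul_neg_of_pos_of_neg (pow_pos h.1 m) hu), pow_succ]
    congr 1
    ring

/-- Period `k`, contraction `c` ⇒ period `k m`, contraction `c^m` (`m ≠ 0`). [cite: Gundlach1997, §2.2] -/
lemma mul_right (h : Z.IsPeriodicDilationContraction k γ c) {m : ℕ} (hm : m ≠ 0) :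
    Z.IsPeriodicDilationContraction (k * m) γ (c ^ m) :=
  ⟨pow_pos h.1 m, pow_lt_one₀ h.1.le h.2.1 hm, fun _ hu ↦ h.iterate_mul_dilation_symm_apply m hu⟩

/-- **Uniqueness of the contraction ratio** for a curve injective on `(-∞, 0)` (compare
`Φ^{-k}(γ(-1)) = γ(-c) = γ(-c')`). [folklore] -/
lemma unique (h : Z.IsPeriodicDilationContraction k γ c) (h' : Z.IsPeriodicDilationContraction k γ c')
    (hinj : InjOn γ (Iio 0)) : c = c' := by
  have h1 := h.iterate_dilation_symm_apply (u := -1) (by norm_num)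
  have h2 := h'.iterate_dilation_symm_apply (u := -1) (by norm_num)
  rw [h1] at h2
  have := hinj (mem_Iio.mpr (h.mul_neg (by norm_num : (-1 : ℝ) < 0)))
    (mem_Iio.mpr (h'.mul_neg (by norm_num : (-1 : ℝ) < 0))) h2
  linarith

/-- The period of an injective curve is never `0` (`Φ^0 = id` would force `γ(-1) = γ(-c)`). [folklore] -/
lemma ne_zero (h : Z.IsPeriodicDilationContraction k γ c) (hinj : InjOn γ (Iio 0)) : k ≠ 0 := by
  rintro rfl
  have h1 := h.iterate_dilation_symm_apply (u := -1) (by norm_num)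
  rw [iterate_zero_apply] at h1
  have := hinj (mem_Iio.mpr (by norm_num : (-1 : ℝ) < 0))
    (mem_Iio.mpr (h.mul_neg (by norm_num : (-1 : ℝ) < 0))) h1
  have := h.lt_one
  linarith

/-- `Φ^{-k}(γ((-∞,0))) = γ((-∞,0))`. [folklore] -/
lemma image_iterate_dilation_symm (h : Z.IsPeriodicDilationContraction k γ c) :
    (Z.dilation.symm)^[k] '' (γ '' Iio 0) = γ '' Iio 0 := by
  ext y
  simp only [mem_image, mem_Iio, exists_exists_and_eq_and]
  constructor
  · rintro ⟨u, hu, rfl⟩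
    exact ⟨c * u, h.mul_neg hu, (h.iterate_dilation_symm_apply hu).symm⟩
  · rintro ⟨u, hu, rfl⟩
    refine ⟨u / c, div_neg_of_neg_of_pos hu h.1, ?_⟩
    rw [h.iterate_dilation_symm_apply (div_neg_of_neg_of_pos hu h.1), mul_div_cancel₀ u h.1.ne']

/-- **Invariance under `Φ^k`, set form**: `Φ^{k}(γ((-∞,0))) = γ((-∞,0))`. [folklore] -/
lemma image_iterate_dilation (h : Z.IsPeriodicDilationContraction k γ c) :
    (Z.dilation)^[k] '' (γ '' Iio 0) = γ '' Iio 0 := by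
  conv_lhs => rw [← h.image_iterate_dilation_symm]
  rw [image_image]
  have hl : (fun x ↦ (Z.dilation)^[k] ((Z.dilation.symm)^[k] x)) = id :=
    funext (Function.LeftInverse.iterate (g := Z.dilation) Z.dilation.apply_symm_apply k)
  rw [hl, image_id]

end IsPeriodicDilationContraction

variable {Z} in
/-- A dilation contraction `c` is a `k`-periodic dilation contraction `c^k` for every `k ≠ 0`
(`Φ^{-k}(γ u) = γ(c^k u)`). Gundlach 1997, §2.2. [cite: Gundlach1997, §2.2] -/
lemma IsDilationContraction.isPeriodicDilationContraction_pow {γ : ℝ → Z.carrier} {c : ℝ}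
    (h : Z.IsDilationContraction γ c) {k : ℕ} (hk : k ≠ 0) :
    Z.IsPeriodicDilationContraction k γ (c ^ k) :=
  ⟨pow_pos h.pos k, pow_lt_one₀ h.pos.le h.lt_one hk, fun _ hu ↦ h.iterate_dilation_symm_apply k hu⟩

namespace IsPeriodicGenerator

variable {Z} {k : ℕ} {γ : ℝ → Z.carrier}

/-- A periodic generator is a maximal geodesic on `(-∞, 0)`. [folklore] -/
lemma isMaximalGeodesicOn (h : Z.IsPeriodicGenerator k γ) :
    IsMaximalGeodesicOn Z.metric.leviCivita γ (Iio 0) := h.1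

/-- A periodic generator is a generator of the cone on `(-∞, 0)`. [folklore] -/
lemma isConeGeneratorOn (h : Z.IsPeriodicGenerator k γ) : Z.IsConeGeneratorOn γ (Iio 0) := h.2.1

/-- A periodic generator is injective on `(-∞, 0)`. [folklore] -/
lemma injOn (h : Z.IsPeriodicGenerator k γ) : InjOn γ (Iio 0) := h.2.2.1

/-- `Φ^{-k}` acts on a `k`-periodic generator by some dilation contraction. [folklore] -/
lemma exists_isPeriodicDilationContraction (h : Z.IsPeriodicGenerator k γ) :
    ∃ c, Z.IsPeriodicDilationContraction k γ c := h.2.2.2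

/-- A periodic generator lies in the cone. [folklore] -/
lemma mapsTo (h : Z.IsPeriodicGenerator k γ) : MapsTo γ (Iio 0) Z.cone := h.isConeGeneratorOn.mapsTo

/-- The period is never `0`. [folklore] -/
lemma ne_zero (h : Z.IsPeriodicGenerator k γ) : k ≠ 0 := by
  obtain ⟨c, hc⟩ := h.exists_isPeriodicDilationContraction
  exact hc.ne_zero h.injOn

/-- The period is `≥ 1` (the normalisation used by the route items). [folklore] -/
lemma one_le (h : Z.IsPeriodicGenerator k γ) : 1 ≤ k := Nat.one_le_iff_ne_zero.mpr h.ne_zero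

/-- A `k`-periodic generator is `k m`-periodic for every `m ≠ 0`. [cite: Gundlach1997, §2.2] -/
lemma mul_right (h : Z.IsPeriodicGenerator k γ) {m : ℕ} (hm : m ≠ 0) :
    Z.IsPeriodicGenerator (k * m) γ := by
  obtain ⟨c, hc⟩ := h.exists_isPeriodicDilationContraction
  exact ⟨h.1, h.2.1, h.2.2.1, c ^ m, hc.mul_right hm⟩

end IsPeriodicGenerator

/-- There are no `0`-periodic generators. [folklore] -/
theorem not_isPeriodicGenerator_zero (γ : ℝ → Z.carrier) : ¬ Z.IsPeriodicGenerator 0 γ :=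
  fun h ↦ h.ne_zero rfl

variable {Z} in
/-- An invariant generator is `k`-periodic for every `k ≠ 0`, with contraction `c₀^k`
(`IsInvariantGenerator.iterate_dilation_symm_apply`). [cite: Gundlach1997, §2.2] -/
theorem IsInvariantGenerator.isPeriodicGenerator {γ : ℝ → Z.carrier} (h : Z.IsInvariantGenerator γ)
    {k : ℕ} (hk : k ≠ 0) : Z.IsPeriodicGenerator k γ :=
  ⟨h.1, h.2.1, h.2.2.1, _, h.isDilationContraction.isPeriodicDilationContraction_pow hk⟩

variable {Z} in
/-- An invariant generator is `k`-periodic for every `k ≥ 1` (the route items' normalisation of the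
period). [cite: Gundlach1997, §2.2] -/
theorem IsInvariantGenerator.isPeriodicGenerator_of_one_le {γ : ℝ → Z.carrier}
    (h : Z.IsInvariantGenerator γ) {k : ℕ} (hk : 1 ≤ k) : Z.IsPeriodicGenerator k γ :=
  h.isPeriodicGenerator (Nat.one_le_iff_ne_zero.mp hk)

/-! ### Iterated contractions and the iterated surface gravity -/

open scoped Classical in
/-- The **affine contraction of `Φ^{-k}` along `γ`**: the ratio `0 < c < 1` with
`Φ^{-k}(γ u) = γ(c u)` (`IsPeriodicDilationContraction`; unique when `γ` is injective on `(-∞,0)`,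
`affineContractionIter_eq`). Junk value `1` when `Φ^{-k}` does not act on `γ` by a dilation
contraction. `k = 1`: `affineContraction` (`affineContractionIter_one`). Object posited by route
`HomotheticSurfaceGravity` (final-state summit). [folklore] -/
def affineContractionIter (k : ℕ) (γ : ℝ → Z.carrier) : ℝ :=
  if h : ∃ c, Z.IsPeriodicDilationContraction k γ c then h.choose else 1

/-- The iterated affine contraction has the defining property whenever some periodic dilation
contraction exists. [folklore] -/
lemma isPeriodicDilationContraction_affineContractionIter {k : ℕ} {γ : ℝ → Z.carrier}
    (h : ∃ c, Z.IsPeriodicDilationContraction k γ c) :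
    Z.IsPeriodicDilationContraction k γ (Z.affineContractionIter k γ) := by
  rw [affineContractionIter, dif_pos h]
  exact h.choose_spec

variable {Z} in
/-- The iterated affine contraction of a curve on which `Φ^{-k}` acts by the dilation contraction
`c`, and which is injective on `(-∞,0)`, is `c`. [folklore] -/
theorem affineContractionIter_eq {k : ℕ} {γ : ℝ → Z.carrier} {c : ℝ}
    (h : Z.IsPeriodicDilationContraction k γ c) (hinj : InjOn γ (Iio 0)) :
    Z.affineContractionIter k γ = c :=
  (Z.isPeriodicDilationContraction_affineContractionIter ⟨c, h⟩).unique h hinj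

/-- `k = 1`: the iterated affine contraction is the affine contraction. [folklore] -/
@[simp] theorem affineContractionIter_one (γ : ℝ → Z.carrier) :
    Z.affineContractionIter 1 γ = Z.affineContraction γ := rfl

/-- The **screen contraction of `Φ^{-k}` at `γ`**: `μ = exp(½ ∫_{-1}^{-c} θ_{γ'(t)}(γ t) dt)` with
`c = affineContractionIter k γ`, so that `μ² = A(-c)/A(-1) = A(Φ^{-k}x)/A(x)`, `x = γ(-1)`, for every
area density `A` of the generator congruence along `γ` (`screenContractionIter_sq_eq_div`;
Hawking–Ellis 1973, §4.4, p. 100, `θ̂ = d log det Â/dv`). `k = 1`: `screenContraction`. Object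
posited by route `HomotheticSurfaceGravity` (final-state summit). [folklore] -/
def screenContractionIter (k : ℕ) (γ : ℝ → Z.carrier) : ℝ :=
  Real.exp ((∫ t in (-1 : ℝ)..(-Z.affineContractionIter k γ), Z.expansionAlong γ t) / 2)

/-- `k = 1`: the iterated screen contraction is the screen contraction. [folklore] -/
@[simp] theorem screenContractionIter_one (γ : ℝ → Z.carrier) :
    Z.screenContractionIter 1 γ = Z.screenContraction γ := rfl

/-- `μ > 0`. [folklore] -/
lemma screenContractionIter_pos (k : ℕ) (γ : ℝ → Z.carrier) : 0 < Z.screenContractionIter k γ :=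
  Real.exp_pos _

/-- `log μ = ½ ∫_{-1}^{-c} θ_{γ'} dt`. [folklore] -/
lemma log_screenContractionIter (k : ℕ) (γ : ℝ → Z.carrier) :
    Real.log (Z.screenContractionIter k γ) =
      (∫ t in (-1 : ℝ)..(-Z.affineContractionIter k γ), Z.expansionAlong γ t) / 2 :=
  Real.log_exp _

/-- `μ² = exp ∫_{-1}^{-c} θ_{γ'} dt`. [folklore] -/
lemma screenContractionIter_sq (k : ℕ) (γ : ℝ → Z.carrier) :
    Z.screenContractionIter k γ ^ 2 =
      Real.exp (∫ t in (-1 : ℝ)..(-Z.affineContractionIter k γ), Z.expansionAlong γ t) := by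
  rw [screenContractionIter, sq, ← Real.exp_add]
  congr 1
  ring

variable {Z} in
/-- **`μ² = A(Φ^{-k}x)/A(x)`**: for every area density `A` of the generator congruence along `γ` on
`[-1, -c]` (with integrable expansion), `μ² = A(-c)/A(-1)` — the fundamental theorem of calculus for
`(log A)' = θ_{γ'}`. Hawking–Ellis 1973, §4.4, p. 100. [cite: HawkingEllis1973, §4.4, p. 100] -/
theorem screenContractionIter_sq_eq_div {k : ℕ} {γ : ℝ → Z.carrier} {A : ℝ → ℝ}
    (hA : Z.IsAreaDensityOn γ (uIcc (-1) (-Z.affineContractionIter k γ)) A)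
    (hθ : IntervalIntegrable (Z.expansionAlong γ) volume (-1) (-Z.affineContractionIter k γ)) :
    Z.screenContractionIter k γ ^ 2 = A (-Z.affineContractionIter k γ) / A (-1) := by
  have hderiv : ∀ t ∈ uIcc (-1 : ℝ) (-Z.affineContractionIter k γ),
      HasDerivAt (fun t ↦ Real.log (A t)) (Z.expansionAlong γ t) t := by
    intro t ht
    obtain ⟨hpos, hA'⟩ := hA t ht
    refine ((Real.hasDerivAt_log hpos.ne').comp t hA').congr_deriv ?_
    rw [mul_comm (Z.expansionAlong γ t) (A t), ← mul_assoc, inv_mul_cancel₀ hpos.ne', one_mul]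
  have hl := (hA _ left_mem_uIcc).1
  have hr := (hA _ right_mem_uIcc).1
  rw [screenContractionIter_sq, integral_eq_sub_of_hasDerivAt hderiv hθ, Real.exp_sub,
    Real.exp_log hr, Real.exp_log hl]

/-- The **homothetic surface gravity of `Z` at `γ` with respect to `Φ^k`**:
`α_k = log c / log μ` with `c = affineContractionIter k γ`, `μ = screenContractionIter k γ` — the
ratio of the logarithmic rates at which `Φ^{-k}` rescales the affine parameter of the generator and
the linear size of the screen. `k = 1`: `homotheticSurfaceGravity` (`homotheticSurfaceGravityIter_one`);
for an invariant generator `α_k = α` (`IsInvariantGenerator.homotheticSurfaceGravityIter_eq`, given the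
equivariance of the expansion). Object posited by route `HomotheticSurfaceGravity` (final-state summit);
Killing-horizon analogue Wald 1984, §12.5. [folklore] -/
def homotheticSurfaceGravityIter (k : ℕ) (γ : ℝ → Z.carrier) : ℝ :=
  Real.log (Z.affineContractionIter k γ) / Real.log (Z.screenContractionIter k γ)

/-- `k = 1`: `α_1 = α`. [folklore] -/
@[simp] theorem homotheticSurfaceGravityIter_one (γ : ℝ → Z.carrier) :
    Z.homotheticSurfaceGravityIter 1 γ = Z.homotheticSurfaceGravity γ := rfl

/-- `α_k = 2 log c / ∫_{-1}^{-c} θ_{γ'} dt`. [folklore] -/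
theorem homotheticSurfaceGravityIter_eq (k : ℕ) (γ : ℝ → Z.carrier) :
    Z.homotheticSurfaceGravityIter k γ = 2 * Real.log (Z.affineContractionIter k γ) /
      ∫ t in (-1 : ℝ)..(-Z.affineContractionIter k γ), Z.expansionAlong γ t := by
  rw [homotheticSurfaceGravityIter, log_screenContractionIter, div_div_eq_mul_div, mul_comm]

/-- `α_k = log c / ((∫_{-1}^{-c} θ_{γ'} dt)/2)` — the quotient as inlined in the route item
`BenignProfileRigidityR`. [folklore] -/
theorem homotheticSurfaceGravityIter_eq_log_div (k : ℕ) (γ : ℝ → Z.carrier) :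
    Z.homotheticSurfaceGravityIter k γ = Real.log (Z.affineContractionIter k γ) /
      ((∫ t in (-1 : ℝ)..(-Z.affineContractionIter k γ), Z.expansionAlong γ t) / 2) := by
  rw [homotheticSurfaceGravityIter, log_screenContractionIter]

namespace IsPeriodicGenerator

variable {Z} {k : ℕ} {γ : ℝ → Z.carrier}

/-- `Φ^{-k}` acts on a `k`-periodic generator by the contraction `c = affineContractionIter k γ`. [folklore] -/
lemma isPeriodicDilationContraction (h : Z.IsPeriodicGenerator k γ) :
    Z.IsPeriodicDilationContraction k γ (Z.affineContractionIter k γ) :=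
  Z.isPeriodicDilationContraction_affineContractionIter h.exists_isPeriodicDilationContraction

/-- `0 < c`. [folklore] -/
lemma affineContractionIter_pos (h : Z.IsPeriodicGenerator k γ) : 0 < Z.affineContractionIter k γ :=
  h.isPeriodicDilationContraction.pos

/-- `c < 1`. [folklore] -/
lemma affineContractionIter_lt_one (h : Z.IsPeriodicGenerator k γ) :
    Z.affineContractionIter k γ < 1 :=
  h.isPeriodicDilationContraction.lt_one

/-- `log c < 0`. [folklore] -/
lemma log_affineContractionIter_neg (h : Z.IsPeriodicGenerator k γ) :
    Real.log (Z.affineContractionIter k γ) < 0 :=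
  Real.log_neg h.affineContractionIter_pos h.affineContractionIter_lt_one

/-- `Φ^{-k}(γ u) = γ(c u)` for `u < 0`. [folklore] -/
lemma iterate_dilation_symm_apply (h : Z.IsPeriodicGenerator k γ) {u : ℝ} (hu : u < 0) :
    (Z.dilation.symm)^[k] (γ u) = γ (Z.affineContractionIter k γ * u) :=
  h.isPeriodicDilationContraction.iterate_dilation_symm_apply hu

/-- **Invariance under `Φ^k`, set form**: `Φ^k(γ((-∞,0))) = γ((-∞,0))`. [folklore] -/
lemma image_iterate_dilation (h : Z.IsPeriodicGenerator k γ) :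
    (Z.dilation)^[k] '' (γ '' Iio 0) = γ '' Iio 0 :=
  h.isPeriodicDilationContraction.image_iterate_dilation

/-- The affine contraction of `Φ^{-km}` along a `k`-periodic generator is `c^m`. [cite: Gundlach1997, §2.2] -/
theorem affineContractionIter_mul (h : Z.IsPeriodicGenerator k γ) {m : ℕ} (hm : m ≠ 0) :
    Z.affineContractionIter (k * m) γ = Z.affineContractionIter k γ ^ m :=
  affineContractionIter_eq (h.isPeriodicDilationContraction.mul_right hm) h.injOn

end IsPeriodicGenerator

variable {Z} in
/-- The affine contraction of `Φ^{-k}` along an invariant generator is `c₀^k`. [cite: Gundlach1997, §2.2] -/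
theorem IsInvariantGenerator.affineContractionIter_eq_pow {γ : ℝ → Z.carrier}
    (h : Z.IsInvariantGenerator γ) {k : ℕ} (hk : k ≠ 0) :
    Z.affineContractionIter k γ = Z.affineContraction γ ^ k :=
  affineContractionIter_eq (h.isDilationContraction.isPeriodicDilationContraction_pow hk) h.injOn

/-! ### Scale-equivariant expansion: iteration invariance of `μ` and `α` -/

/-- A scale-equivariant function, `θ t = c θ(c t)` for `t < 0`, satisfies `θ t = c^j θ(c^j t)`. [folklore] -/
theorem eq_pow_mul_apply_of_forall_eq_mul {θ : ℝ → ℝ} {c : ℝ} (hc : 0 < c)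
    (hθ : ∀ t < 0, θ t = c * θ (c * t)) (j : ℕ) {t : ℝ} (ht : t < 0) :
    θ t = c ^ j * θ (c ^ j * t) := by
  induction j with
  | zero => simp
  | succ j ih =>
    rw [ih, hθ (c ^ j * t) (mul_neg_of_pos_of_neg (pow_pos hc j) ht), pow_succ,
      mul_assoc (c ^ j) c (θ _), mul_left_comm c (c ^ j) t, mul_assoc (c ^ j) c t]

/-- For a scale-equivariant `θ` (`θ t = c θ(c t)`, `t < 0`, `0 < c`) the integrals over the
fundamental domains `[-c^j, -c^{j+1}]` all agree with `∫_{-1}^{-c} θ` (change of variables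
`t ↦ c^j t`; no integrability needed). [folklore] -/
theorem integral_pow_eq_of_forall_eq_mul {θ : ℝ → ℝ} {c : ℝ} (hc : 0 < c)
    (hθ : ∀ t < 0, θ t = c * θ (c * t)) (j : ℕ) :
    ∫ t in (-c ^ j)..(-c ^ (j + 1)), θ t = ∫ t in (-1 : ℝ)..(-c), θ t := by
  have hcong : EqOn θ (fun t ↦ c ^ j * θ (c ^ j * t)) (uIcc (-1) (-c)) := by
    intro t ht
    refine eq_pow_mul_apply_of_forall_eq_mul hc hθ j ?_
    rcases mem_uIcc.mp ht with ⟨_, h2⟩ | ⟨_, h2⟩ <;> linarith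
  have hs := intervalIntegral.smul_integral_comp_mul_left (a := -1) (b := -c) θ (c ^ j)
  rw [mul_neg_one, _root_.mul_neg, ← pow_succ, smul_eq_mul,
    ← intervalIntegral.integral_const_mul] at hs
  rw [integral_congr hcong, hs]

/-- For a scale-equivariant `θ` (`θ t = c θ(c t)` for `t < 0`, `0 < c < 1`):
`∫_{-1}^{-c^m} θ = m ∫_{-1}^{-c} θ` — the `m` fundamental domains contribute equally. Holds without
integrability assumptions (in the non-integrable case both sides vanish). [folklore] -/
theorem integral_eq_mul_of_forall_eq_mul {θ : ℝ → ℝ} {c : ℝ} (hc : 0 < c) (hc1 : c < 1)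
    (hθ : ∀ t < 0, θ t = c * θ (c * t)) (m : ℕ) :
    ∫ t in (-1 : ℝ)..(-c ^ m), θ t = m * ∫ t in (-1 : ℝ)..(-c), θ t := by
  by_cases hint : IntervalIntegrable θ volume (-1) (-c)
  · have hj : ∀ j : ℕ, IntervalIntegrable θ volume (-c ^ j) (-c ^ (j + 1)) := by
      intro j
      have hcj : (0 : ℝ) < c ^ j := pow_pos hc j
      have h1 : IntervalIntegrable (fun x ↦ θ ((c ^ j)⁻¹ * x)) volume ((-1) / (c ^ j)⁻¹)
          ((-c) / (c ^ j)⁻¹) := hint.comp_mul_left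
      rw [div_inv_eq_mul, div_inv_eq_mul, neg_one_mul, neg_mul, ← pow_succ'] at h1
      refine (intervalIntegrable_congr ?_).mp (h1.const_mul (c ^ j)⁻¹)
      intro s hs
      have hs0 : s < 0 := by
        have hcj1 : (0 : ℝ) < c ^ (j + 1) := pow_pos hc (j + 1)
        rcases mem_uIoc.mp hs with ⟨_, h2⟩ | ⟨_, h2⟩ <;> linarith
      have h2 := eq_pow_mul_apply_of_forall_eq_mul hc hθ j (t := (c ^ j)⁻¹ * s)
        (mul_neg_of_pos_of_neg (inv_pos.mpr hcj) hs0)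
      rw [mul_inv_cancel_left₀ hcj.ne'] at h2
      change (c ^ j)⁻¹ * θ ((c ^ j)⁻¹ * s) = θ s
      rw [h2, inv_mul_cancel_left₀ hcj.ne']
    have hsum := intervalIntegral.sum_integral_adjacent_intervals (μ := volume) (f := θ)
      (a := fun j ↦ -c ^ j) (n := m) (fun j _ ↦ hj j)
    simp only [pow_zero] at hsum
    rw [← hsum, Finset.sum_congr rfl (fun j _ ↦ integral_pow_eq_of_forall_eq_mul hc hθ j),
      Finset.sum_const, Finset.card_range, nsmul_eq_mul]
  · rcases Nat.eq_zero_or_pos m with rfl | hm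
    · simp
    · have hint' : ¬ IntervalIntegrable θ volume (-1) (-c ^ m) := by
        intro h
        refine hint (h.mono_set (uIcc_subset_uIcc left_mem_uIcc (mem_uIcc.mpr (Or.inl ⟨?_, ?_⟩))))
        · linarith
        · exact neg_le_neg (pow_le_of_le_one hc.le hc1.le hm.ne')
      rw [integral_undef hint, integral_undef hint', mul_zero]

namespace IsPeriodicGenerator

variable {Z} {k : ℕ} {γ : ℝ → Z.carrier}

/-- **Iteration invariance of the screen contraction**: for a `k`-periodic generator along which the
expansion is `Φ^k`-equivariant (`θ_{γ'}(t) = c θ_{γ'}(c t)`, `c = affineContractionIter k γ`),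
`μ_{km} = μ_k^m`. [cite: Gundlach1997, §2.2] -/
theorem screenContractionIter_mul (h : Z.IsPeriodicGenerator k γ) {m : ℕ} (hm : m ≠ 0)
    (hθ : ∀ t < 0, Z.expansionAlong γ t =
      Z.affineContractionIter k γ * Z.expansionAlong γ (Z.affineContractionIter k γ * t)) :
    Z.screenContractionIter (k * m) γ = Z.screenContractionIter k γ ^ m := by
  rw [screenContractionIter, screenContractionIter, h.affineContractionIter_mul hm,
    integral_eq_mul_of_forall_eq_mul h.affineContractionIter_pos h.affineContractionIter_lt_one hθ m,
    mul_div_assoc, Real.exp_nat_mul]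

/-- **Iteration invariance of the surface gravity**: for a `k`-periodic generator along which the
expansion is `Φ^k`-equivariant, `α_{km} = α_k` (`(c, μ) ↦ (c^m, μ^m)`, `log_pow_div_log_pow`).
[cite: Gundlach1997, §2.2] -/
theorem homotheticSurfaceGravityIter_mul (h : Z.IsPeriodicGenerator k γ) {m : ℕ} (hm : m ≠ 0)
    (hθ : ∀ t < 0, Z.expansionAlong γ t =
      Z.affineContractionIter k γ * Z.expansionAlong γ (Z.affineContractionIter k γ * t)) :
    Z.homotheticSurfaceGravityIter (k * m) γ = Z.homotheticSurfaceGravityIter k γ := by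
  rw [homotheticSurfaceGravityIter, homotheticSurfaceGravityIter, h.screenContractionIter_mul hm hθ,
    h.affineContractionIter_mul hm, log_pow_div_log_pow _ _ hm]

end IsPeriodicGenerator

variable {Z} in
/-- **`α_k = α` for an invariant generator** (`k ≠ 0`), given the `Φ`-equivariance of the expansion
along it, `θ_{γ'}(t) = c₀ θ_{γ'}(c₀ t)` for `t < 0` (areas scale by a constant under the homothety and
`dΦ⁻¹ γ'(u) = c₀ γ'(c₀ u)`; cf. the *Base point* design note of `HomotheticSurfaceGravity.lean`):
replacing `Φ` by `Φ^k` replaces `(c₀, μ₀)` by `(c₀^k, μ₀^k)`. [cite: Gundlach1997, §2.2] -/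
theorem IsInvariantGenerator.homotheticSurfaceGravityIter_eq {γ : ℝ → Z.carrier}
    (h : Z.IsInvariantGenerator γ) {k : ℕ} (hk : k ≠ 0)
    (hθ : ∀ t < 0, Z.expansionAlong γ t =
      Z.affineContraction γ * Z.expansionAlong γ (Z.affineContraction γ * t)) :
    Z.homotheticSurfaceGravityIter k γ = Z.homotheticSurfaceGravity γ := by
  have h1 : Z.IsPeriodicGenerator 1 γ := Z.isPeriodicGenerator_one_iff.mpr h
  have := h1.homotheticSurfaceGravityIter_mul hk (by rwa [affineContractionIter_one])
  rwa [one_mul, homotheticSurfaceGravityIter_one] at this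

/-! ### Completeness of the vertex past cone -/

/-- The unit `2`-sphere `S² ⊂ ℝ³`, the space of generators of a complete cone. [folklore] -/
abbrev generatorSphere : Type := Metric.sphere (0 : EuclideanSpace ℝ (Fin 3)) 1

variable {Z} in
/-- The **`u`-line of direction `ω`** of a trivialisation `e : 𝒩 ≃ₜ S² × ℝ` of the cone:
`u ↦ e⁻¹(ω, log(-u))` (meaningful for `u < 0`; the `ℝ`-coordinate is `s = log(-u)`, so `u ↑ 0` is
`s → -∞`). For a complete cone (`IsConeComplete`) these are the normalised generators.
Rodnianski–Shlapentokh-Rothman 2023, Thm. 1 (the cone `{v̂ = 0} ≅ [u] × S²`). Object posited by route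
`HomotheticSurfaceGravity` (final-state summit). [folklore] -/
def coneTrivLine (e : Z.cone ≃ₜ generatorSphere × ℝ) (w : generatorSphere) : ℝ → Z.carrier :=
  fun u ↦ ((e.symm (w, Real.log (-u)) : Z.cone) : Z.carrier)

/-- **The vertex past cone of `Z` is complete**: there is a homeomorphism `e : 𝒩 ≃ₜ S² × ℝ`
(the space of generators is a `2`-sphere) all of whose `u`-lines `u ↦ e⁻¹(ω, log(-u))`, `u < 0`, are
maximal geodesics with parameter domain `(-∞, 0)` — affinely parametrised, finite future (vertex)
end at `u = 0` — and future-directed null geodesic generators of `𝒩` there (`IsConeGeneratorOn`).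
Rodnianski–Shlapentokh-Rothman 2023, Thm. 1: the cone `{v̂ = 0}` of the self-similar vacuum
space-times is `(u, θ) ∈ [-v̲², 0) × S²` with the scaling field `S = u∂_u` tangent to it;
Christodoulou 2009, Ch. 1, §1.1: the generators of a null geodesic cone `C_o` are the affinely
parametrised future-directed null geodesics from `o`, one for each direction at `o`, without cut or
conjugate points. Object posited by route `HomotheticSurfaceGravity` (final-state summit) (repair
`C′` of `BenignProfileRigidity`); the packaging (trivialisation by normalised generators in the
parameter `log(-u)`) is this file's. [folklore] -/
def IsConeComplete (Z : SelfSimilarVacuumProfile.{u} n) : Prop :=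
  ∃ e : Z.cone ≃ₜ (Metric.sphere (0 : EuclideanSpace ℝ (Fin 3)) 1) × ℝ,
    ∀ w : Metric.sphere (0 : EuclideanSpace ℝ (Fin 3)) 1,
      IsMaximalGeodesicOn Z.metric.leviCivita
          (fun u : ℝ ↦ ((e.symm (w, Real.log (-u)) : Z.cone) : Z.carrier)) (Iio 0) ∧
        Z.IsConeGeneratorOn (fun u : ℝ ↦ ((e.symm (w, Real.log (-u)) : Z.cone) : Z.carrier))
          (Iio 0)

/-- Unfolding of `IsConeComplete` into the clause inlined in the route items
`BenignProfileRigidityR` / `PeriodicShearRigidity`. [folklore] -/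
theorem isConeComplete_iff :
    Z.IsConeComplete ↔
      ∃ e : Z.cone ≃ₜ (Metric.sphere (0 : EuclideanSpace ℝ (Fin 3)) 1) × ℝ,
        ∀ w : Metric.sphere (0 : EuclideanSpace ℝ (Fin 3)) 1,
          IsMaximalGeodesicOn Z.metric.leviCivita
              (fun u : ℝ ↦ ((e.symm (w, Real.log (-u)) : Z.cone) : Z.carrier)) (Iio 0) ∧
            Z.IsConeGeneratorOn
              (fun u : ℝ ↦ ((e.symm (w, Real.log (-u)) : Z.cone) : Z.carrier)) (Iio 0) :=
  Iff.rfl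

/-- `IsConeComplete` in terms of the `u`-lines `coneTrivLine`. [folklore] -/
theorem isConeComplete_iff_coneTrivLine :
    Z.IsConeComplete ↔ ∃ e : Z.cone ≃ₜ generatorSphere × ℝ, ∀ w,
      IsMaximalGeodesicOn Z.metric.leviCivita (coneTrivLine e w) (Iio 0) ∧
        Z.IsConeGeneratorOn (coneTrivLine e w) (Iio 0) :=
  Iff.rfl

section coneTrivLine

variable {Z} (e : Z.cone ≃ₜ generatorSphere × ℝ)

/-- Unfolding of `coneTrivLine`. [folklore] -/
@[simp] lemma coneTrivLine_apply (w : generatorSphere) (u : ℝ) :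
    coneTrivLine e w u = ((e.symm (w, Real.log (-u)) : Z.cone) : Z.carrier) := rfl

/-- The `u`-lines lie in the cone. [folklore] -/
lemma coneTrivLine_mem_cone (w : generatorSphere) (u : ℝ) : coneTrivLine e w u ∈ Z.cone :=
  (e.symm (w, Real.log (-u))).2

/-- The `u`-lines lie in the cone (`MapsTo` form). [folklore] -/
lemma mapsTo_coneTrivLine (w : generatorSphere) (s : Set ℝ) : MapsTo (coneTrivLine e w) s Z.cone :=
  fun u _ ↦ coneTrivLine_mem_cone e w u

/-- The trivialisation reads off direction and parameter: `e(line_ω(u)) = (ω, log(-u))`. [folklore] -/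
lemma apply_coneTrivLine (w : generatorSphere) (u : ℝ) :
    e ⟨coneTrivLine e w u, coneTrivLine_mem_cone e w u⟩ = (w, Real.log (-u)) := by
  simp [coneTrivLine]

/-- Two line points with negative parameters coincide iff directions and parameters do
(`e⁻¹` and `log` on `(0, ∞)` are injective). [folklore] -/
lemma coneTrivLine_eq_coneTrivLine_iff {w w' : generatorSphere} {u u' : ℝ} (hu : u < 0)
    (hu' : u' < 0) : coneTrivLine e w u = coneTrivLine e w' u' ↔ w = w' ∧ u = u' := by
  constructor
  · intro h
    have h1 : e.symm (w, Real.log (-u)) = e.symm (w', Real.log (-u')) := Subtype.ext h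
    have h2 := e.symm.injective h1
    simp only [Prod.mk.injEq] at h2
    refine ⟨h2.1, ?_⟩
    have := Real.log_injOn_pos (mem_Ioi.mpr (neg_pos.mpr hu)) (mem_Ioi.mpr (neg_pos.mpr hu')) h2.2
    linarith
  · rintro ⟨rfl, rfl⟩
    rfl

/-- Each `u`-line is injective on `(-∞, 0)` (the `InjOn` clause of `IsPeriodicGenerator`). [folklore] -/
lemma injOn_coneTrivLine (w : generatorSphere) : InjOn (coneTrivLine e w) (Iio 0) :=
  fun _ hu _ hu' h ↦ ((coneTrivLine_eq_coneTrivLine_iff e hu hu').mp h).2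

/-- Distinct directions give disjoint lines (on negative parameters). [folklore] -/
lemma coneTrivLine_ne_of_ne {w w' : generatorSphere} (hw : w ≠ w') {u u' : ℝ} (hu : u < 0)
    (hu' : u' < 0) : coneTrivLine e w u ≠ coneTrivLine e w' u' :=
  fun h ↦ hw ((coneTrivLine_eq_coneTrivLine_iff e hu hu').mp h).1

/-- **The line through a point of the cone**: every `x ∈ 𝒩` is `e⁻¹(ω, log(-u))` for the direction
`ω = (e x).1` and the parameter `u = -exp((e x).2) < 0`. [folklore] -/
lemma exists_coneTrivLine_eq {x : Z.carrier} (hx : x ∈ Z.cone) :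
    ∃ w : generatorSphere, ∃ u < 0, coneTrivLine e w u = x := by
  refine ⟨(e ⟨x, hx⟩).1, -Real.exp ((e ⟨x, hx⟩).2), neg_neg_of_pos (Real.exp_pos _), ?_⟩
  rw [coneTrivLine_apply, neg_neg, Real.log_exp, Prod.mk.eta, Homeomorph.symm_apply_apply]

/-- The `u`-lines, `u < 0`, sweep out the cone. [folklore] -/
lemma iUnion_image_coneTrivLine : ⋃ w, coneTrivLine e w '' Iio 0 = Z.cone := by
  ext x
  simp only [mem_iUnion, mem_image, mem_Iio]
  constructor
  · rintro ⟨w, u, -, rfl⟩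
    exact coneTrivLine_mem_cone e w u
  · intro hx
    obtain ⟨w, u, hu, h⟩ := exists_coneTrivLine_eq e hx
    exact ⟨w, u, hu, h⟩

end coneTrivLine

namespace IsConeComplete

variable {Z}

/-- **Every point of a complete cone lies on a normalised generator**: through `x ∈ 𝒩` passes a
maximal geodesic `γ` on `(-∞,0)` which is a generator of `𝒩` there, injective, with `γ u = x` for
some `u < 0`. [folklore] -/
theorem exists_generator (h : Z.IsConeComplete) {x : Z.carrier} (hx : x ∈ Z.cone) :
    ∃ (γ : ℝ → Z.carrier) (u : ℝ), IsMaximalGeodesicOn Z.metric.leviCivita γ (Iio 0) ∧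
      Z.IsConeGeneratorOn γ (Iio 0) ∧ InjOn γ (Iio 0) ∧ u < 0 ∧ γ u = x := by
  obtain ⟨e, he⟩ := h
  obtain ⟨w, u, hu, hx'⟩ := exists_coneTrivLine_eq e hx
  exact ⟨coneTrivLine e w, u, (he w).1, (he w).2, injOn_coneTrivLine e w, hu, hx'⟩

/-- The lines of a completeness trivialisation are injective normalised generators: if in addition
`Φ^{-k}` acts on the line of direction `ω` by a dilation contraction, that line is a `k`-periodic
generator. [folklore] -/
theorem isPeriodicGenerator_coneTrivLine {e : Z.cone ≃ₜ generatorSphere × ℝ}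
    (he : ∀ w, IsMaximalGeodesicOn Z.metric.leviCivita (coneTrivLine e w) (Iio 0) ∧
      Z.IsConeGeneratorOn (coneTrivLine e w) (Iio 0))
    {k : ℕ} {w : generatorSphere} {c : ℝ}
    (hc : Z.IsPeriodicDilationContraction k (coneTrivLine e w) c) :
    Z.IsPeriodicGenerator k (coneTrivLine e w) :=
  ⟨(he w).1, (he w).2, injOn_coneTrivLine e w, c, hc⟩

end IsConeComplete

/-! ### Bridges to the inline clauses of the route items -/

/-- **Bridge (existential form).** "There are `γ`, `c` with: `γ` maximal geodesic and generator on
`(-∞,0)`, injective, `0 < c < 1`, `Φ^{-k}(γ u) = γ(c u)` for `u < 0`, and `P γ c`" — the shape of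
the conclusion of `BenignProfileRigidityR` — iff there is a `k`-periodic generator `γ` with
`P γ (affineContractionIter k γ)`. [folklore] -/
theorem exists_isPeriodicGenerator_iff (k : ℕ) (P : (ℝ → Z.carrier) → ℝ → Prop) :
    (∃ (γ : ℝ → Z.carrier) (c : ℝ), IsMaximalGeodesicOn Z.metric.leviCivita γ (Iio 0) ∧
        Z.IsConeGeneratorOn γ (Iio 0) ∧ InjOn γ (Iio 0) ∧ 0 < c ∧ c < 1 ∧
          (∀ u : ℝ, u < 0 → (Z.dilation.symm)^[k] (γ u) = γ (c * u)) ∧ P γ c) ↔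
      ∃ γ : ℝ → Z.carrier, Z.IsPeriodicGenerator k γ ∧ P γ (Z.affineContractionIter k γ) := by
  constructor
  · rintro ⟨γ, c, h1, h2, h3, hc0, hc1, hc, hP⟩
    have hpc : Z.IsPeriodicDilationContraction k γ c := ⟨hc0, hc1, hc⟩
    refine ⟨γ, ⟨h1, h2, h3, c, hpc⟩, ?_⟩
    rwa [Z.affineContractionIter_eq hpc h3]
  · rintro ⟨γ, hγ, hP⟩
    have hc := hγ.isPeriodicDilationContraction
    exact ⟨γ, _, hγ.1, hγ.2.1, hγ.2.2.1, hc.1, hc.2.1, hc.2.2, hP⟩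

/-- **Bridge (surface-gravity form).** The conclusion of `BenignProfileRigidityR` — a periodic
generator with `a < log c / ((∫_{-1}^{-c} θ_{γ'})/2)` — iff there is a `k`-periodic generator `γ`
with `a < α_k(γ)` (`homotheticSurfaceGravityIter`). [folklore] -/
theorem exists_isPeriodicGenerator_lt_iff (k : ℕ) (a : ℝ) :
    (∃ (γ : ℝ → Z.carrier) (c : ℝ), IsMaximalGeodesicOn Z.metric.leviCivita γ (Iio 0) ∧
        Z.IsConeGeneratorOn γ (Iio 0) ∧ InjOn γ (Iio 0) ∧ 0 < c ∧ c < 1 ∧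
          (∀ u : ℝ, u < 0 → (Z.dilation.symm)^[k] (γ u) = γ (c * u)) ∧
            a < Real.log c / ((∫ t in (-1 : ℝ)..(-c), Z.expansionAlong γ t) / 2)) ↔
      ∃ γ : ℝ → Z.carrier, Z.IsPeriodicGenerator k γ ∧ a < Z.homotheticSurfaceGravityIter k γ := by
  simp only [homotheticSurfaceGravityIter_eq_log_div]
  exact Z.exists_isPeriodicGenerator_iff k
    (fun γ c ↦ a < Real.log c / ((∫ t in (-1 : ℝ)..(-c), Z.expansionAlong γ t) / 2))

/-- **Bridge (surface-gravity form, with the period quantifier).** The full conclusion of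
`BenignProfileRigidityR` — "for some `k ≥ 1` there is a `k`-periodic generator with
`a < log c / ((∫_{-1}^{-c} θ_{γ'})/2)`" — iff some periodic generator has `a < α_k`; the bound
`1 ≤ k` is automatic (`IsPeriodicGenerator.one_le`). [folklore] -/
theorem exists_exists_isPeriodicGenerator_lt_iff (a : ℝ) :
    (∃ k : ℕ, 1 ≤ k ∧ ∃ (γ : ℝ → Z.carrier) (c : ℝ),
        IsMaximalGeodesicOn Z.metric.leviCivita γ (Iio 0) ∧ Z.IsConeGeneratorOn γ (Iio 0) ∧
          InjOn γ (Iio 0) ∧ 0 < c ∧ c < 1 ∧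
            (∀ u : ℝ, u < 0 → (Z.dilation.symm)^[k] (γ u) = γ (c * u)) ∧
              a < Real.log c / ((∫ t in (-1 : ℝ)..(-c), Z.expansionAlong γ t) / 2)) ↔
      ∃ (k : ℕ) (γ : ℝ → Z.carrier),
        Z.IsPeriodicGenerator k γ ∧ a < Z.homotheticSurfaceGravityIter k γ := by
  simp only [exists_isPeriodicGenerator_lt_iff]
  constructor
  · rintro ⟨k, -, γ, hγ, ha⟩
    exact ⟨k, γ, hγ, ha⟩
  · rintro ⟨k, γ, hγ, ha⟩
    exact ⟨k, hγ.one_le, γ, hγ, ha⟩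

/-- **Bridge (universal form).** "For all `k ≥ 1`, `γ`, `c` with the periodic-generator clauses,
`P k γ`" — the shape of the hypothesis of `PeriodicShearRigidity` — iff `P k γ` for every `k`-periodic
generator `γ` (the bound `1 ≤ k` is automatic, `IsPeriodicGenerator.one_le`). [folklore] -/
theorem forall_isPeriodicGenerator_iff (P : ℕ → (ℝ → Z.carrier) → Prop) :
    (∀ (k : ℕ) (γ : ℝ → Z.carrier) (c : ℝ), 1 ≤ k →
        IsMaximalGeodesicOn Z.metric.leviCivita γ (Iio 0) → Z.IsConeGeneratorOn γ (Iio 0) →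
          InjOn γ (Iio 0) → 0 < c → c < 1 →
            (∀ u : ℝ, u < 0 → (Z.dilation.symm)^[k] (γ u) = γ (c * u)) → P k γ) ↔
      ∀ (k : ℕ) (γ : ℝ → Z.carrier), Z.IsPeriodicGenerator k γ → P k γ := by
  constructor
  · rintro h k γ hγ
    have hk := hγ.one_le
    obtain ⟨h1, h2, h3, c, hc0, hc1, hc⟩ := hγ
    exact h k γ c hk h1 h2 h3 hc0 hc1 hc
  · intro h k γ c _ h1 h2 h3 hc0 hc1 hc
    exact h k γ ⟨h1, h2, h3, c, hc0, hc1, hc⟩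

end SelfSimilarVacuumProfile

end Literature.Geometry.Lorentzian

end
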